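import Literature.NumberTheory.ComplexMultiplication.EllipticUnits.ImaginaryQuadraticMainConjectureCarriers
import HarnessLib

/-!
# M-LINE-PIN / (α3) ROW 2, FILE 3a: THE TWISTED KUMMER CLASS EXISTS — a constructor for ty2's predicate
# `JohnsonLeungKings2011.IsTwistedKummerClass`

Cell `bsd-print-cf2`, WIDTH seat `bsd-line-cf2-p1-w6` g8 (prover-bsd-line-cf2-p1-w6-g8-0); (α3) ROW 2 on the DECIDING child stmt-BirchSwinnertonDyer-24721
(memo `HOME/bsd-line-cf2-p1-w6/ROW2-SPEC-w6g8.md`, (R2-3)/(R2-11)); `--supports` that item (helper, Theses-free). HONEST FRAMING: cohomological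
bookkeeping; nothing here closes the crux; no summit statement is proved by this seat; BSD is not proved by any of this. THEOREMS ONLY (no definition,
no named fact, no instance, no `sorry`).

WHAT. ty2 g37's carriers file pins the elliptic-unit classes `aZeta` of the JLK skeleton through the PREDICATE
`IsTwistedKummerClass p θ S U k β c` («`c ∈ H¹(G_S(F), μ_{p^k} ⊗ θ)` is represented by a cocycle whose value at the image of every `σ ∈ U = Gal(K̄/F)`
is `σβ/β`»). Both consumers — the F0 construction (-w5 g9) and ROW 2's units-side map (`…RowTwoUnitsLift`, the `kum n k` of its H-side) — need
the CONSTRUCTOR: for `U` open with `θ|_U = 1` and `θ|_{N_S} = 1`, `N_S` fixing `μ_{p^k}` and `β`, and `(σβ/β)^{p^k} = 1` for `σ ∈ U` (i.e. `β^{p^k}`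
in the fixed field of `U`), THERE IS such a class (`exists_isTwistedKummerClass`), and it is UNIQUE (`isTwistedKummerClass_unique`). The cocycle is
`g ↦ σ_g β/β` for any lift `σ_g ∈ U` of `g ∈ U_S = imGS S U` (lift-independent because `N_S` fixes `β`); it is locally constant (the stabiliser of
`β` is open and `Γ_K ↠ G_S` is open) and satisfies the cocycle law for the twisted action because `θ|_U = 1` makes the twist invisible on `U`.

* §1 `smul_div_eq_of_quot_eq` (lift independence), `exists_lift_mem` (lifts in `U` of elements of `imGS S U`);
* §2 **`exists_isTwistedKummerClass`**, **`isTwistedKummerClass_unique`**.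

References: J. Johnson-Leung, G. Kings, J. reine angew. Math. 653 (2011) §3.3 (5)–(6), Def. 3.5; J.-P. Serre, *Local Fields* X §3 b).
-/

noncomputable section

open scoped Classical

-- the summit namespace `Summit.BirchSwinnertonDyer.BirchSwinnertonDyer` repeats the problem name by design (D-0017)
set_option linter.dupNamespace false
set_option autoImplicit false

open scoped NumberField
open Field IsDedekindDomain
open Literature.NumberTheory.GaloisRepresentations Literature.NumberTheory.GaloisRepresentations.DiscreteGaloisModule
open Literature.NumberTheory.ComplexMultiplication.EllipticUnits.JohnsonLeungKings2011

namespace Summit.BirchSwinnertonDyer.BirchSwinnertonDyer.Theorems.PrintCf2.RowTwo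

variable {K : Type} [Field K] [NumberField K] (p : ℕ) [Fact p.Prime] (S : Set (HeightOneSpectrum (𝓞 K)))
  (θ : absoluteGaloisGroup K →ₜ* ℤ_[p]ˣ) (k : ℕ) (U : Subgroup (absoluteGaloisGroup K))

/-! ## §1. Lifts -/

omit [NumberField K] in
/-- Two lifts in `Γ_K` of the same element of `G_S` give the same `σβ/β` when `N_S` fixes `β`. [cite: JohnsonLeungKings2011, §3.3 (5) (arXiv p0010:L61–70)] -/
theorem smul_div_eq_of_quot_eq {β : (AlgebraicClosure K)ˣ} (hβN : ∀ τ ∈ ramificationSubgroup K S, τ • β = β)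
    {σ σ' : absoluteGaloisGroup K} (h : toUnramifiedQuot K S σ = toUnramifiedQuot K S σ') : σ' • β / β = σ • β / β := by
  have hmem : σ⁻¹ * σ' ∈ ramificationSubgroup K S := QuotientGroup.eq.mp h
  have h1 : (σ⁻¹ * σ') • β = β := hβN _ hmem
  rw [mul_smul, inv_smul_eq_iff] at h1
  rw [h1]

omit [NumberField K] in
/-- Every element of `U_S = imGS S U` lifts to `U`. [folklore] -/
theorem exists_lift_mem (g : imGS S U) : ∃ σ ∈ U, toUnramifiedQuot K S σ = (g : GaloisGroupUnramifiedOutside K S) :=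
  Subgroup.mem_map.mp g.2

/-! ## §2. The constructor -/

omit [NumberField K] in
/-- **THE TWISTED KUMMER CLASS EXISTS.** For `U ≤ Γ_K` open with `θ|_U = 1`, `θ|_{N_S} = 1`, `N_S` fixing the `p^k`-th roots of unity and `β`, and
`(σβ/β)^{p^k} = 1` for all `σ ∈ U`: there is `c ∈ H¹(G_S(F), μ_{p^k} ⊗ θ)` with `IsTwistedKummerClass p θ S U k β c`.
[cite: JohnsonLeungKings2011, §3.3 (5)–(6) and Def. 3.5 (arXiv p0010:L55–80)] [cite: Serre1979, Ch. X §3 b)] -/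
theorem exists_isTwistedKummerClass (hU : IsOpen (U : Set (absoluteGaloisGroup K))) (hθU : ∀ σ ∈ U, θ σ = 1)
    (hθN : ∀ τ ∈ ramificationSubgroup K S, θ τ = 1)
    (hμN : ∀ τ ∈ ramificationSubgroup K S, ∀ ζ : (AlgebraicClosure K)ˣ, ζ ^ (p ^ k) = 1 → τ • ζ = ζ)
    (β : (AlgebraicClosure K)ˣ) (hβN : ∀ τ ∈ ramificationSubgroup K S, τ • β = β)
    (hβU : ∀ σ ∈ U, (σ • β / β) ^ (p ^ k) = 1) :
    ∃ c : levelCoh p S θ U k 1, IsTwistedKummerClass p θ S U k β c := by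
  classical
  -- the ambient `G_S`-module and its carrier
  let X := (coeffGS p S θ k).toTopRep
  -- lifts
  have hlift : ∀ g : imGS S U, ∃ σ ∈ U, toUnramifiedQuot K S σ = (g : GaloisGroupUnramifiedOutside K S) := exists_lift_mem S U
  choose lift hliftU hlift_eq using hlift
  -- the value `σβ/β` as an `N_S`-invariant element of `μ_{p^k} ⊗ θ`
  let rt : ∀ σ : absoluteGaloisGroup K, σ ∈ U → rootsOfUnity (p ^ k) (AlgebraicClosure K) := fun σ hσ ↦
    ⟨σ • β / β, (mem_rootsOfUnity _ _).mpr (hβU σ hσ)⟩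
  have hval_mem : ∀ (σ : absoluteGaloisGroup K) (hσ : σ ∈ U),
      MuCarrier.ofRootsOfUnity (rt σ hσ) ∈
        Representation.invariants ((muTwist p θ k).toRepresentation.comp (ramificationSubgroup K S).subtype) := by
    intro σ hσ
    rw [Representation.mem_invariants]
    intro τ
    apply muVal_injective K (p ^ k)
    change muVal K (p ^ k) (muTwist p θ k (τ : absoluteGaloisGroup K) (MuCarrier.ofRootsOfUnity (rt σ hσ))) = _
    rw [muTwist_apply_of_apply_eq_one p θ k (hθN τ τ.2), muVal_apply, muVal_ofRootsOfUnity]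
    exact hμN τ τ.2 _ (hβU σ hσ)
  let val : imGS S U → X := fun g ↦ ⟨MuCarrier.ofRootsOfUnity (rt (lift g) (hliftU g)), hval_mem (lift g) (hliftU g)⟩
  have hval : ∀ g : imGS S U, muVal K (p ^ k) ((val g : Representation.invariants
      ((muTwist p θ k).toRepresentation.comp (ramificationSubgroup K S).subtype)) : MuCarrier K (p ^ k)) =
      lift g • β / β := fun g ↦ rfl
  -- any lift in `U` computes the value
  have hval_of : ∀ (g : imGS S U) (σ : absoluteGaloisGroup K), toUnramifiedQuot K S σ = (g : GaloisGroupUnramifiedOutside K S) →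
      muVal K (p ^ k) ((val g : Representation.invariants
        ((muTwist p θ k).toRepresentation.comp (ramificationSubgroup K S).subtype)) : MuCarrier K (p ^ k)) = σ • β / β := by
    intro g σ hσg
    rw [hval]
    exact smul_div_eq_of_quot_eq S hβN (hσg.trans (hlift_eq g).symm)
  -- injectivity of `muVal ∘ coe` on `X`
  have hinj : ∀ w w' : X, muVal K (p ^ k) ((w : Representation.invariants
        ((muTwist p θ k).toRepresentation.comp (ramificationSubgroup K S).subtype)) : MuCarrier K (p ^ k)) =
      muVal K (p ^ k) ((w' : Representation.invariants
        ((muTwist p θ k).toRepresentation.comp (ramificationSubgroup K S).subtype)) : MuCarrier K (p ^ k)) → w = w' :=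
    fun w w' h ↦ Subtype.ext (muVal_injective K (p ^ k) h)
  -- the action of `g ∈ U_S` on `X` read in `K̄ˣ`: `g·w = (lift g)·w` (θ trivial on `U`)
  have hρ : ∀ (g : imGS S U) (w : X), muVal K (p ^ k) (((subgroupRep X (imGS S U)).ρ g w : Representation.invariants
        ((muTwist p θ k).toRepresentation.comp (ramificationSubgroup K S).subtype)) : MuCarrier K (p ^ k)) =
      lift g • muVal K (p ^ k) ((w : Representation.invariants
        ((muTwist p θ k).toRepresentation.comp (ramificationSubgroup K S).subtype)) : MuCarrier K (p ^ k)) := by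
    intro g w
    rw [subgroupRep_ρ_apply]
    have hg : ((g : imGS S U) : GaloisGroupUnramifiedOutside K S) = toUnramifiedQuot K S (lift g) := (hlift_eq g).symm
    rw [hg]
    change muVal K (p ^ k) (muTwist p θ k (lift g) _) = _
    rw [muTwist_apply_of_apply_eq_one p θ k (hθU _ (hliftU g)), muVal_apply]
    rfl
  -- local constancy
  have hlc : IsLocallyConstant val := by
    rw [IsLocallyConstant.iff_exists_open]
    intro g₀
    let T : Set (absoluteGaloisGroup K) := (U : Set (absoluteGaloisGroup K)) ∩ {σ | σ • β = lift g₀ • β}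
    have hT : IsOpen T := hU.inter ((isLocallyConstant_smul_units (K := K) β).isOpen_fiber (lift g₀ • β))
    refine ⟨Subtype.val ⁻¹' (toUnramifiedQuot K S '' T), (isOpenMap_toUnramifiedQuot K S _ hT).preimage continuous_subtype_val,
      ⟨lift g₀, ⟨hliftU g₀, rfl⟩, hlift_eq g₀⟩, fun g hg ↦ ?_⟩
    obtain ⟨σ, ⟨hσU, hσβ⟩, hσg⟩ := hg
    apply hinj
    rw [hval_of g σ hσg, hval g₀]
    exact congrArg (· / β) hσβ
  -- the cocycle
  let φ : contOneCocycles (subgroupRep X (imGS S U)) := ⟨⟨val, hlc.continuous⟩, fun g h ↦ by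
    apply hinj
    change muVal K (p ^ k) ((val (g * h) : Representation.invariants
        ((muTwist p θ k).toRepresentation.comp (ramificationSubgroup K S).subtype)) : MuCarrier K (p ^ k)) =
      muVal K (p ^ k) (((val g + (subgroupRep X (imGS S U)).ρ g (val h) : X) : Representation.invariants
        ((muTwist p θ k).toRepresentation.comp (ramificationSubgroup K S).subtype)) : MuCarrier K (p ^ k))
    have hgh : toUnramifiedQuot K S (lift g * lift h) = ((g * h : imGS S U) : GaloisGroupUnramifiedOutside K S) := by
      rw [map_mul, hlift_eq, hlift_eq]; rfl
    rw [hval_of (g * h) (lift g * lift h) hgh, Submodule.coe_add, muVal_add, hρ, hval, hval, mul_smul, smul_div',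
      mul_comm, div_mul_div_cancel]⟩
  refine ⟨oneCocycleClass _ φ, φ, rfl, fun σ hσ ↦ ?_⟩
  exact hval_of ⟨toUnramifiedQuot K S σ, Subgroup.mem_map_of_mem _ hσ⟩ σ rfl

omit [NumberField K] in
/-- **Uniqueness**: the twisted Kummer class of `β` at level `U` is unique (its cocycle is determined on all of `U_S = imGS S U`, every element of which
lifts to `U`). [cite: JohnsonLeungKings2011, §3.3 (5)–(6) (arXiv p0010:L61–70)] -/
theorem isTwistedKummerClass_unique {β : (AlgebraicClosure K)ˣ} {c c' : levelCoh p S θ U k 1}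
    (hc : IsTwistedKummerClass p θ S U k β c) (hc' : IsTwistedKummerClass p θ S U k β c') : c = c' := by
  obtain ⟨φ, rfl, hφ⟩ := hc
  obtain ⟨φ', rfl, hφ'⟩ := hc'
  congr 1
  refine Subtype.ext (ContinuousMap.ext fun g ↦ ?_)
  obtain ⟨σ, hσ, hσg⟩ := exists_lift_mem S U g
  have hg : g = ⟨toUnramifiedQuot K S σ, Subgroup.mem_map_of_mem _ hσ⟩ := Subtype.ext hσg.symm
  subst hg
  exact Subtype.ext (muVal_injective K (p ^ k) ((hφ σ hσ).trans (hφ' σ hσ).symm))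

end Summit.BirchSwinnertonDyer.BirchSwinnertonDyer.Theorems.PrintCf2.RowTwo

end
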